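import Literature.Barriers.CriticalPhenomena.WeaklySAWPerturbativeFlowTheorem
import HarnessLib

/-!
# BBS 2015, §7.3, Step 3 of the proof of Proposition 7.1.1 at the massless base points, modulo (A3):
# for the 4d weakly SAW the weights `χ_j(m²)` are EVENTUALLY CONSTANT (`= 1`) as `m² ↓ 0`, so the
# hypothesis "`χ_j(m'²) → χ_j(m²)`" of Corollary 7.2.2 / [BBS-rg-flow, Cor 1.8] holds at `m² = 0`

Source: Bauerschmidt–Brydges–Slade, CMP 337 (2015) [BBS2015], §7.3, Step 3 ("Proof that `z₀ᶜ, μ₀ᶜ`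
are continuous on `[0,δ)²`") and its preparation: "the mass scale `j_m` differs from `j_Ω` by at
most a constant, so … `‖·‖_{𝒲̃_j(m²,g₀)} = ‖·‖_{𝒲̃_j(0,g₀)}` for `m² ≤ cL^{-2j}`" — the scale-`j` data
do not see a small mass. For the weights of (A1)–(A2) this is the elementary fact proved here:
`j_Ω(β(m²)) ≥ j_m(m²) - M → ∞` as `m² ↓ 0` (`jOmega_betaPT_massScale`), hence for each fixed `j`,
`χ_j(m²) = Ω^{-(j-j_Ω(m²))₊} = 1 = χ_j(0)` for all small `m² ≥ 0`.

Consequently the tree's [BBS-rg-flow, Corollary 1.8] (`critFlow_continuousWithinAt`, whose only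
hypothesis beyond (A1)–(A3) and the continuity of `Φ` is `χ_j(m') → χ_j(m)` at the base point) applies
to the weakly SAW AT EVERY MASSLESS BASE POINT `(0, K₀, g₀)` with no extra hypothesis: this is the
`m² = 0` boundary case of the continuity statement of Proposition 7.1.1 (Step 3), modulo (A3). (The
interior case `m̃² > 0`, where `j_Ω` jumps, is `BBS2015_cor722_frozen_of_hypA3` with frozen weights.)

* `chi_betaPT_eq_one_of_small` — `∃ ε > 0`, `χ_j(m²) = 1` for all `m² ∈ [0, ε)`;
* `continuousWithinAt_chi_betaPT_zero` — `m² ↦ χ_j(m²)` is continuous at `0` within `[0,∞)`;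
* **`BBS2015_cor722_massless_of_hypA3`** — Corollary 7.2.2 for WSAW at base points `q₀ = (0, K₀, g₀)`:
  continuity of the critical flow (in particular of `(z₀ᶜ, μ₀ᶜ)`) in `(m², K₀, g₀)` at `q₀` within the
  admissible set, given (A3) there and the joint continuity of `(ψ, ρ)`.
-/

noncomputable section

open Set Filter Topology

namespace Literature.Barriers.CriticalPhenomena

namespace CTWSAW

/-- **`χ_j(m²) = 1` for all small `m² ≥ 0`** (`j` fixed): `j ≤ j_m(m²) - M ≤ j_Ω(β(m²))` once
`m² < L^{-2(j+M+1)}`. [cite: BauerschmidtBrydgesSlade2015LogCorr, §7.3 (Step 3: "the scale-j norm is independent of m² as long as j ≤ min{j_Ω, j_m}"; §6.1 "|j_m - j_Ω| ≤ O(1)")] -/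
theorem chi_betaPT_eq_one_of_small {L : ℝ} (hL : 2 ≤ L) {Ω : ℝ} (hΩ : 1 < Ω) (j : ℕ) :
    ∃ ε : ℝ, 0 < ε ∧ ∀ s : ℝ, 0 ≤ s → s < ε → chi (betaPT 4 L s) Ω j = 1 := by
  have hL1 : (1 : ℝ) < L := by linarith
  have hL0 : (0 : ℝ) < L := by linarith
  obtain ⟨δ, hδ, hδ1, M, hM⟩ := jOmega_betaPT_massScale hL hΩ
  refine ⟨min δ ((L ^ (2 * (j + M + 1)))⁻¹), lt_min hδ (by positivity), fun s hs hsε => ?_⟩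
  rcases hs.eq_or_lt with rfl | hspos
  · exact chi_betaPT_zero hL hΩ j
  · have hsδ : s ≤ δ := (hsε.trans_le (min_le_left _ _)).le
    obtain ⟨jm, hjm, hjm'⟩ := exists_massScale hL1 hspos (hsδ.trans hδ1)
    obtain ⟨-, hle⟩ := hM s hspos hsδ jm hjm hjm'
    -- `jm ≥ j + M + 1`: from `sL^{2(jm+1)} > 1 > sL^{2(j+M+1)}`
    have hlt : s * L ^ (2 * (j + M + 1)) < 1 := by
      have h1 : s < (L ^ (2 * (j + M + 1)))⁻¹ := hsε.trans_le (min_le_right _ _)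
      have h2 : 0 < L ^ (2 * (j + M + 1)) := by positivity
      rwa [lt_inv_comm₀ hspos h2, inv_eq_one_div, lt_div_iff₀ hspos, mul_comm] at h1
    have hjM : j + M + 1 ≤ jm := by
      by_contra hcon
      push Not at hcon
      have : L ^ (2 * (jm + 1)) ≤ L ^ (2 * (j + M + 1)) := pow_le_pow_right₀ hL1.le (by omega)
      have := mul_le_mul_of_nonneg_left this hspos.le
      linarith
    -- hence `j ≤ j_Ω(β(s))` and the weight is `1`
    refine chi_eq_one_of_le ?_
    have h1 : ((j + M : ℕ) : ℕ∞) ≤ (jm : ℕ∞) := by exact_mod_cast (by omega : j + M ≤ jm)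
    have h2 : (j : ℕ∞) + M ≤ jOmega (betaPT 4 L s) Ω + M := by
      calc (j : ℕ∞) + M = ((j + M : ℕ) : ℕ∞) := by push_cast; ring
        _ ≤ jm := h1
        _ ≤ jOmega (betaPT 4 L s) Ω + M := hle
    exact (ENat.add_le_add_iff_right (ENat.coe_ne_top M)).1 h2

/-- **`m² ↦ χ_j(m²)` is continuous at `m² = 0` within `[0,∞)`** (eventually constant).
[cite: BauerschmidtBrydgesSlade2015LogCorr, §7.3 (Step 3)] -/
theorem continuousWithinAt_chi_betaPT_zero {L : ℝ} (hL : 2 ≤ L) {Ω : ℝ} (hΩ : 1 < Ω) (j : ℕ) :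
    ContinuousWithinAt (fun s : ℝ => chi (betaPT 4 L s) Ω j) (Ici 0) 0 := by
  obtain ⟨ε, hε, h1⟩ := chi_betaPT_eq_one_of_small hL hΩ j
  have hev : ∀ᶠ s in 𝓝[Ici 0] (0 : ℝ), chi (betaPT 4 L s) Ω j = chi (betaPT 4 L 0) Ω j := by
    have hmem : Ico (0 : ℝ) ε ∈ 𝓝[Ici 0] (0 : ℝ) := Ico_mem_nhdsGE hε
    filter_upwards [hmem] with s hs
    rw [h1 s hs.1 hs.2, h1 0 le_rfl hε]
  exact (tendsto_const_nhds.congr' (hev.mono fun s hs => hs.symm))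

/-- **BBS 2015, Corollary 7.2.2 at the massless base points for the 4d weakly SAW, modulo (A3)**
(§7.3, Step 3 of the proof of Proposition 7.1.1, the case `m̃² = 0`): with the external parameter
`m² ∈ [0,δ]`, `φ̄(m²) = wsawQuadFlow L m²` ((A1)–(A2) and coefficient continuity discharged), maps
`ψ(m²), ρ(m²)` jointly continuous in `(m², x)` on the domains, and an admissible base point
`q₀ = (0, K₀, g₀)` of MASS ZERO: the critical flow `x_j(m², K₀, g₀)` — in particular
`(z₀ᶜ, μ₀ᶜ)(m², K₀, g₀)` — is continuous at `q₀` within the admissible set; the hypothesis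
"`χ_j(m') → χ_j(m)`" of the abstract Corollary 1.8 is DISCHARGED here (`χ_j` is eventually `1`).
[cite: BauerschmidtBrydgesSlade2015LogCorr, §7.3 (Step 3) and Corollary 7.2.2] [cite: BauerschmidtBrydgesSlade2015Flow, Corollary 1.8] -/
theorem BBS2015_cor722_massless_of_hypA3 {L : ℝ} (hL : 2 ≤ L) {δ Ω B c C : ℝ} (hΩ : 1 < Ω)
    (hA : ∀ m : massParams δ, HypA1 (wsawQuadFlow L (m : ℝ)).β Ω B c ∧ HypA2 (wsawQuadFlow L (m : ℝ)) Ω (L ^ 2) c C)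
    {a κ R M aStar b hh : ℝ} (hc : ConstHyp Ω c (L ^ 2) C a κ R M aStar b hh)
    {W : ℕ → Type*} [∀ j, NormedAddCommGroup (W j)] [∀ j, NormedSpace ℝ (W j)] [∀ j, CompleteSpace (W j)]
    (ψf : ∀ m : massParams δ, ∀ j, W j × V3 → W (j + 1)) (ρf : ∀ m : massParams δ, ∀ j, W j × V3 → V3)
    (hψ : ∀ (j : ℕ) (m : massParams δ) (g : ℝ) (x : W j × V3),
      x ∈ flowDomain (chi (wsawQuadFlow L (m : ℝ)).β Ω) ((wsawQuadFlow L (m : ℝ)).flow g) a hh j →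
      ContinuousAt (fun p : massParams δ × (W j × V3) => ψf p.1 j p.2) (m, x))
    (hρ : ∀ (j : ℕ) (m : massParams δ) (g : ℝ) (x : W j × V3),
      x ∈ flowDomain (chi (wsawQuadFlow L (m : ℝ)).β Ω) ((wsawQuadFlow L (m : ℝ)).flow g) a hh j →
      ContinuousAt (fun p : massParams δ × (W j × V3) => ρf p.1 j p.2) (m, x))
    {q₀ : massParams δ × (W 0 × ℝ)} (hq₀0 : ((q₀.1 : massParams δ) : ℝ) = 0)
    (hq₀ : Adm (fun m : massParams δ => wsawQuadFlow L (m : ℝ)) ψf ρf Ω B c (L ^ 2) C a κ R M aStar b hh q₀) (j : ℕ) :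
    ContinuousWithinAt (fun q => critFlow ψf ρf hc hA q j)
      {q | Adm (fun m : massParams δ => wsawQuadFlow L (m : ℝ)) ψf ρf Ω B c (L ^ 2) C a κ R M aStar b hh q} q₀ := by
  refine BBS2015_cor722_of_hypA3 hL hA hc ψf ρf hψ hρ hq₀ (fun i => ?_) j
  -- `χ_i(m²) → χ_i(0)` along `massParams δ` at the base mass `0`
  have hcw := continuousWithinAt_chi_betaPT_zero hL hΩ i
  have hmem : ((q₀.1 : massParams δ) : ℝ) ∈ Icc (0 : ℝ) δ := q₀.1.2
  have h1 : ContinuousWithinAt (fun s : ℝ => chi (betaPT 4 L s) Ω i) (Icc 0 δ) ((q₀.1 : massParams δ) : ℝ) := by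
    rw [hq₀0]
    exact hcw.mono Icc_subset_Ici_self
  have h2 := (continuousWithinAt_iff_continuousAt_restrict (fun s : ℝ => chi (betaPT 4 L s) Ω i) hmem).1 h1
  exact h2

end CTWSAW

end Literature.Barriers.CriticalPhenomena
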